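import Summits.BirchSwinnertonDyer.BirchSwinnertonDyer.Theorems.ByReductionTypeAtTwoMultTowerNS2LocalLayerField
import Literature.NumberTheory.EllipticCurves.OrdinaryLocalReductionMapProofs
import Literature.NumberTheory.EllipticCurves.ReductionHomomorphismSurjectiveProofs
import Literature.NumberTheory.EllipticCurves.IwasawaSelmerControlLocalInputsProofs
import Literature.NumberTheory.EllipticCurves.GaloisActionProofs
import Literature.RingTheory.DiscreteValuationRing.AdicCompletionHensel
import Literature.NumberTheory.GaloisRepresentations.GaloisRepUnramifiedProofs
import Literature.NumberTheory.EllipticCurves.FormalGroupKummerPointProofs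
import HarnessLib

/-!
# Route `ByReductionTypeAtTwo`, item `OrdKatoHalfAtTwo` (stmt-BirchSwinnertonDyer-19271), TOWER road, the
# GOOD-ORDINARY local constant at `v ∣ p`: KERNEL BRICK G4 — the arithmetic inputs of the dévissage (inertial
# generator, reduction is inertia-invariant, Hensel lifts of Frobenius-fixed reductions, `#Ẽ(k̄)[p] ≤ p`)

HONEST FRAMING (cell `bsd-2adic`, run/shared/lean/pub/bsd-2adic/, seat `bsd-2adic-tower-1` GEN 11, HUMAN RULINGS
D-0036 / D-0054 / D-0074): TOOL theorems only (no definition, no named fact, no `sorry`); closes nothing by itself;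
nothing booked; BSD is not proved by any of this. Step S1 of the KERNELISATION of the consumed projection
`#𝒦_{v,n}[2^∞][2] ≤ 4` of the PRINT binder `hS34 = Greenberg1999.lemma34_localTowerKerPrimary_cyclicExtension_rat`
(scope memo HOME/tower/SCOPE-hS34-layer-kernel-at-2-GEN7.md §1, §3): the hypotheses `hrD` / `hlift` / `#T[p]` of BRICK G1
(`GoodOrdTower.natCard_torsionBy_quotient_le_of_invariant`) for `M = E(K̄_v)^{H_∞}`, `D = g − 1`, `r = red₀`, in the
setting and vocabulary of `OrdinaryLocalReductionMapProofs` (`W/ℚ` globally minimal, `v ∋ p`, spectral valuation `w`,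
`red₀ : E(K̄_v) → Ẽ(k̄_w)` the reduction of the local integral model).

* `exists_inertial_generator` — a topological generator `g` of `H_n` over `H_∞` lying in the INERTIA group `I_{ℚ_v}`
  (GEN 8 `MultTowerNS2.exists_mem_absInertia_mem_localSubgroup_kerSubgroup` + `ZpExtension.exists_mem_localSubgroup_generate`);
* `localRed_smul_eq_of_mem_absInertia` — **`red₀ (g • Q) = red₀ Q` for `g ∈ I_{ℚ_v}`** (inertia fixes the prime-to-`p` roots
  of unity, `mem_absInertia_iff_smul_rootsOfUnity`; `exists_layer_localRed_smul_eq`);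
* `exists_fixed_localRed_eq` — **Hensel**: a point `Q ∈ E(K̄_v)` whose reduction is fixed by the arithmetic Frobenius `τ`
  (`red₀ (τ • Q) = red₀ Q`) has the same reduction as some `ℚ_v`-RATIONAL point `P₀` (`σ • P₀ = P₀` for all `σ`): the
  coordinates of `red₀ Q` satisfy `x̄^q = x̄`, so lie in `𝔽_v` (`residueMap_pow_eq_of_reducePoint_smul_eq`), and the
  `𝔽_v`-point lifts to `E(ℚ_v)` by Hensel's lemma over `ℤ_v` (`WeierstrassCurve.exists_equation_residue_eq`, AEC VII.2.1);
* `finite_torsionBy_localRed_target`, `natCard_torsionBy_localRed_target_le` — at a good ORDINARY `v ∣ p`: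
  `#Ẽ(k̄_w)[p] ≤ p` (`red₀ : E[p] ↠ Ẽ[p]` with kernel of order `p`, `#E[p] = p²`; `localRed_ordinary_filtration`).

References: J. Silverman, *AEC* (2009), VII.2.1, VII.3.1, III.6.4; R. Greenberg, LNM 1716 (1999), §1 p. 62, §2 pp. 69–70;
L. Washington, *Cyclotomic Fields*, §13.1; scope memo §1, §3.
-/

set_option autoImplicit false
-- the Theorems namespace of this sub repeats the summit name by design (D-0017 nested layout: Summit.<S>.<Sub>)
set_option linter.dupNamespace false

noncomputable section

open scoped Classical NNReal ValuativeRel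

namespace Summit.BirchSwinnertonDyer.BirchSwinnertonDyer.Theorems.GoodOrdTower

open NumberField IsDedekindDomain Field Polynomial Literature.NumberTheory.EllipticCurves
  Literature.NumberTheory.GaloisRepresentations IsDedekindDomain.HeightOneSpectrum
  Literature.NumberTheory.EllipticCurves.FormalGroupChart WeierstrassCurve

variable {p : ℕ} [hp : Fact p.Prime] {κ : ZpExtension ℚ p}

/-! ## §A An inertial topological generator of `H_n` over `H_∞` -/

/-- **An inertial topological generator of the layer**: for the cyclotomic `ℤ_p`-extension `κ` and `v ∋ p` there is
`g` in the inertia group `I_{ℚ_v}` lying in `H_n = localSubgroup (κ.layerSubgroup n) ℚ_v` such that every open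
subgroup containing `H_∞ = localSubgroup κ.kerSubgroup ℚ_v` and `g` contains `H_n` (`ℚ_v(μ_{p^∞})/ℚ_v` is totally
ramified: `Γ = I · H_∞`). [cite: Washington1997, §13.1] -/
theorem exists_inertial_generator (hκ : κ.IsCyclotomic) (v : HeightOneSpectrum (𝓞 ℚ))
    (hv : (p : 𝓞 ℚ) ∈ v.asIdeal) (n : ℕ) :
    ∃ g : absoluteGaloisGroup (v.adicCompletion ℚ), g ∈ absInertia (v.adicCompletion ℚ) ∧
      g ∈ localSubgroup (κ.layerSubgroup n) (v.adicCompletion ℚ) ∧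
      ∀ U : Subgroup (absoluteGaloisGroup (v.adicCompletion ℚ)),
        IsOpen (U : Set (absoluteGaloisGroup (v.adicCompletion ℚ))) →
          localSubgroup κ.kerSubgroup (v.adicCompletion ℚ) ≤ U → g ∈ U →
            localSubgroup (κ.layerSubgroup n) (v.adicCompletion ℚ) ≤ U := by
  obtain ⟨g₀, hg₀, hgen₀⟩ := ZpExtension.exists_mem_localSubgroup_generate κ (v.adicCompletion ℚ) n
  obtain ⟨τ, hτI, hτ⟩ := MultTowerNS2.exists_mem_absInertia_mem_localSubgroup_kerSubgroup hκ v hv g₀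
  have hle : localSubgroup κ.kerSubgroup (v.adicCompletion ℚ) ≤
      localSubgroup (κ.layerSubgroup n) (v.adicCompletion ℚ) := fun σ hσ ↦
    (mem_localSubgroup_iff _ _ _).mpr (κ.kerSubgroup_le_layerSubgroup n ((mem_localSubgroup_iff _ _ _).mp hσ))
  refine ⟨τ, hτI, ?_, fun U hU hHU hτU ↦ hgen₀ U hU hHU ?_⟩
  · have h : τ = g₀ * (τ⁻¹ * g₀)⁻¹ := by group
    rw [h]
    exact mul_mem hg₀ (inv_mem (hle hτ))
  · have h : g₀ = τ * (τ⁻¹ * g₀) := by group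
    rw [h]
    exact mul_mem hτU (hHU hτ)

/-! ## §B The reduction map is inertia-invariant -/

variable (W : WeierstrassCurve ℚ) [W.IsGloballyMinimal] {v : HeightOneSpectrum (𝓞 ℚ)}
  {w : Valuation (AlgebraicClosure (v.adicCompletion ℚ)) ℝ≥0}
  (hw : ∀ x, (w x : ℝ) = spectralNorm (v.adicCompletion ℚ) (AlgebraicClosure (v.adicCompletion ℚ)) x)
  (hΔu : IsUnit ((integralModelInt W).map (algebraMap ℤ ↥w.valuationSubring)).Δ)
  (red₀ : localPoints W (v.adicCompletion ℚ) →+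
    (((integralModelInt W).map (algebraMap ℤ ↥w.valuationSubring)).map
      (IsLocalRing.residue ↥w.valuationSubring)).toAffine.Point)
  (hred₀ : ∀ P : localPoints W (v.adicCompletion ℚ), red₀ P =
    ((integralModelInt W).map (algebraMap ℤ ↥w.valuationSubring)).reducePoint
      (Affine.Point.congrEquiv (localIntModel_baseChange W w.valuationSubring).symm P))

include hw hred₀ in
/-- **`red₀ (g • Q) = red₀ Q` for `g` in the inertia group** (`v ∋ p`, `𝔐` a prime of `𝒪_{K̄_v}` over `v`): the inertia
group fixes every root of unity of order prime to `p` (`mem_absInertia_iff_smul_rootsOfUnity`), in particular a primitive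
`(q^f − 1)`-th one, and every `σ` fixing such a root with `f` large does not move the reduction of `Q`
(`exists_layer_localRed_smul_eq`, Serre *Local Fields* II §4 Prop. 8). [cite: SerreLocalFields1979, Ch. II §4 Prop. 8] -/
theorem localRed_smul_eq_of_mem_absInertia (hpv : (p : 𝓞 ℚ) ∈ v.asIdeal) {𝔐 : Ideal v.localAbsIntegers}
    (h𝔐 : 𝔐 ∈ v.localPrimesAbove) {g : absoluteGaloisGroup (v.adicCompletion ℚ)}
    (hg : g ∈ absInertia (v.adicCompletion ℚ)) (Q : localPoints W (v.adicCompletion ℚ)) :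
    red₀ (g • Q) = red₀ Q := by
  obtain ⟨f, hf, hlayer⟩ := W.exists_layer_localRed_smul_eq hw red₀ hred₀ h𝔐 {Q}
  -- `q = p`
  have hq : Nat.card (IsLocalRing.ResidueField (v.adicCompletionIntegers ℚ)) = p := by
    rw [natCard_residueField_adicCompletionIntegers v, Rat.HeightOneSpectrum.primesEquiv_eq_of_natCast_mem v hp.out hpv]
  rw [hq] at hlayer
  -- a primitive `(p^f - 1)`-th root of unity of `K̄_v`
  have hN0 : p ^ f - 1 ≠ 0 := (Nat.sub_pos_of_lt (Nat.one_lt_pow hf hp.out.one_lt)).ne'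
  haveI : CharZero (AlgebraicClosure (v.adicCompletion ℚ)) :=
    charZero_of_injective_algebraMap (algebraMap ℚ (AlgebraicClosure (v.adicCompletion ℚ))).injective
  haveI : NeZero ((p ^ f - 1 : ℕ) : AlgebraicClosure (v.adicCompletion ℚ)) := ⟨Nat.cast_ne_zero.mpr hN0⟩
  obtain ⟨ζ, hζ⟩ := HasEnoughRootsOfUnity.prim (M := AlgebraicClosure (v.adicCompletion ℚ)) (n := p ^ f - 1)
  -- inertia fixes it: `p ∤ p^f - 1`
  have hunit : IsUnit ((p ^ f - 1 : ℕ) : 𝒪[v.adicCompletion ℚ]) := by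
    have hcop : ¬ p ∣ p ^ f - 1 := by
      intro h
      have h1 : p ∣ p ^ f := dvd_pow_self p hf
      have h2 : p ∣ p ^ f - (p ^ f - 1) := Nat.dvd_sub h1 h
      rw [Nat.sub_sub_self (Nat.one_le_pow f p hp.out.pos)] at h2
      exact hp.out.one_lt.ne' (Nat.dvd_one.mp h2)
    have hw1 : w (algebraMap (v.adicCompletion ℚ) (AlgebraicClosure (v.adicCompletion ℚ))
        ((p ^ f - 1 : ℕ) : v.adicCompletion ℚ)) = 1 := by
      rw [map_natCast]
      exact spectralValuation_natCast_eq_one_of_not_dvd hpv hw hcop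
    have hnorm : ‖((p ^ f - 1 : ℕ) : v.adicCompletion ℚ)‖ = 1 := by
      have h := hw (algebraMap (v.adicCompletion ℚ) (AlgebraicClosure (v.adicCompletion ℚ))
        ((p ^ f - 1 : ℕ) : v.adicCompletion ℚ))
      rw [spectralNorm_extends, hw1, NNReal.coe_one] at h
      exact h.symm
    rw [(Valuation.integer.integers (ValuativeRel.valuation (v.adicCompletion ℚ))).isUnit_iff_valuation_eq_one]
    change ValuativeRel.valuation (v.adicCompletion ℚ) (((p ^ f - 1 : ℕ) : 𝒪[v.adicCompletion ℚ]) : v.adicCompletion ℚ) = 1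
    rw [show (((p ^ f - 1 : ℕ) : 𝒪[v.adicCompletion ℚ]) : v.adicCompletion ℚ) =
      ((p ^ f - 1 : ℕ) : v.adicCompletion ℚ) from by simp]
    refine le_antisymm ((adicCompletion_valuation_le_one_iff ℚ v _).mpr hnorm.le) (not_lt.mp fun hlt ↦ ?_)
    exact absurd hnorm (ne_of_lt ((adicCompletion_valuation_lt_one_iff ℚ v _).mp hlt))
  have hgζ : g • ζ = ζ :=
    (mem_absInertia_iff_smul_rootsOfUnity.mp hg) (p ^ f - 1) hunit ζ hζ.pow_eq_one
  exact hlayer ζ hζ g hgζ Q (Finset.mem_singleton_self Q)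


variable [W.IsElliptic]

/-! ## §C Hensel: Frobenius-fixed reductions come from `ℚ_v`-rational points -/

include hw hΔu hred₀ in
/-- **Hensel lift of a Frobenius-fixed reduction.** For `W/ℚ` globally minimal with `p ∤ Δ_W`, `v ∋ p`, an arithmetic
Frobenius `τ` at a prime `𝔐` of `𝒪_{K̄_v}` over `v`, and a point `Q ∈ E(K̄_v)` with `red₀ (τ • Q) = red₀ Q`: there is a
`ℚ_v`-RATIONAL point `P₀` (fixed by all of `Γ_{ℚ_v}`) with `red₀ P₀ = red₀ Q`.  The coordinates `x̄, ȳ ∈ k̄_w` of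
`red₀ Q` satisfy `x̄^q = x̄` (`residueMap_pow_eq_of_reducePoint_smul_eq`), so they come from `𝔽_v` (the `q` roots of
`X^q − X`); the `𝔽_v`-point of the reduction `W_ℤ ⊗ 𝔽_v` (non-singular: good reduction) lifts to `W_ℤ(ℤ_v)` by Hensel's
lemma (`WeierstrassCurve.exists_equation_residue_eq`, `ℤ_v` henselian), and the lift reduces in `k̄_w` to `red₀ Q`
(`exists_residueMap`'s compatibility with `ℤ_v → 𝔽_v → k̄_w`). [cite: SilvermanAEC2009, VII.2 Prop. 2.1 (PDF p. 167)]
[cite: GreenbergLNM1716, §2 p. 70] -/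
theorem exists_fixed_localRed_eq (hpv : (p : 𝓞 ℚ) ∈ v.asIdeal) (hΔ : ¬ (p : ℤ) ∣ minimalDiscriminantInt W)
    {𝔐 : Ideal v.localAbsIntegers} (h𝔐 : 𝔐 ∈ v.localPrimesAbove)
    {τ : absoluteGaloisGroup (v.adicCompletion ℚ)} (hτ : IsArithFrobAt (v.adicCompletionIntegers ℚ) τ 𝔐)
    (Q : localPoints W (v.adicCompletion ℚ)) (hQ : red₀ (τ • Q) = red₀ Q) :
    ∃ P₀ : localPoints W (v.adicCompletion ℚ),
      (∀ σ : absoluteGaloisGroup (v.adicCompletion ℚ), σ • P₀ = P₀) ∧ red₀ P₀ = red₀ Q := by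
  have hvO : w.Integers w.valuationSubring := Valuation.valuationSubring.integers w
  haveI hV : (W.baseChange (AlgebraicClosure (v.adicCompletion ℚ))).IsIntegral w.integer :=
    ⟨⟨(integralModelInt W).map (algebraMap ℤ ↥w.integer), W.baseChange_eq_localIntModel_integer_baseChange⟩⟩
  obtain ⟨r, hr, hrc, hrF⟩ := exists_residueMap (v := v) hw h𝔐
  haveI : Finite (IsLocalRing.ResidueField (v.adicCompletionIntegers ℚ)) :=
    finite_residueField_adicCompletionIntegers ℚ v
  -- `r` factors through the residue field of `𝒪_w`, injectively
  have hker : ∀ a ∈ IsLocalRing.maximalIdeal ↥w.valuationSubring, r a = 0 := by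
    intro a ha
    rw [IsLocalRing.mem_maximalIdeal, mem_nonunits_iff, hvO.isUnit_iff_valuation_eq_one] at ha
    exact (hr a).mpr (lt_of_le_of_ne ((Valuation.mem_valuationSubring_iff w _).mp a.2) ha)
  let rt : IsLocalRing.ResidueField ↥w.valuationSubring →+*
      AlgebraicClosure (IsLocalRing.ResidueField (v.adicCompletionIntegers ℚ)) :=
    Ideal.Quotient.lift (IsLocalRing.maximalIdeal ↥w.valuationSubring) r hker
  have hrt : ∀ a, rt (IsLocalRing.residue ↥w.valuationSubring a) = r a := fun a ↦ Ideal.Quotient.lift_mk _ _ _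
  have hrt_inj : Function.Injective rt := RingHom.injective _
  rcases Q with _ | ⟨x, y, h⟩
  · exact ⟨0, fun σ ↦ smul_zero σ, rfl⟩
  by_cases hx : w x ≤ 1
  swap
  · -- non-integral abscissa: `Q` reduces to `0`
    refine ⟨0, fun σ ↦ smul_zero σ, ?_⟩
    rw [map_zero]
    exact ((W.localRed_eq_zero_iff_mem_kernel hΔu red₀ hred₀ _).mpr (some_mem_kernel h (not_le.mp hx))).symm
  -- the coordinates of the reduction satisfy `c^q = c`
  have heq := hQ
  rw [hred₀, hred₀] at heq
  obtain ⟨hy, hxq, hyq⟩ := residueMap_pow_eq_of_reducePoint_smul_eq hw hr hrF hτ hΔu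
    (localIntModel_baseChange W w.valuationSubring) hx rfl heq
  -- such elements of `k̄` come from `𝔽_v`
  have hroots : ∀ c : AlgebraicClosure (IsLocalRing.ResidueField (v.adicCompletionIntegers ℚ)),
      c ^ Nat.card (IsLocalRing.ResidueField (v.adicCompletionIntegers ℚ)) = c →
        ∃ c₀ : IsLocalRing.ResidueField (v.adicCompletionIntegers ℚ), algebraMap (IsLocalRing.ResidueField (v.adicCompletionIntegers ℚ)) (AlgebraicClosure (IsLocalRing.ResidueField (v.adicCompletionIntegers ℚ))) c₀ = c := by
    intro c hc
    set q := Nat.card (IsLocalRing.ResidueField (v.adicCompletionIntegers ℚ)) with hq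
    haveI : Fintype (IsLocalRing.ResidueField (v.adicCompletionIntegers ℚ)) := Fintype.ofFinite _
    have hq1 : 1 < q := by rw [hq]; exact Finite.one_lt_card
    let f : Polynomial (AlgebraicClosure (IsLocalRing.ResidueField (v.adicCompletionIntegers ℚ))) := X ^ q - X
    have hf0 : f ≠ 0 := FiniteField.X_pow_card_sub_X_ne_zero _ hq1
    have hdeg : f.natDegree = q := FiniteField.X_pow_card_sub_X_natDegree_eq _ hq1
    -- the image of `𝔽_v` consists of roots of `f` and has `q` elements
    let S : Finset (AlgebraicClosure (IsLocalRing.ResidueField (v.adicCompletionIntegers ℚ))) :=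
      Finset.univ.image (algebraMap (IsLocalRing.ResidueField (v.adicCompletionIntegers ℚ)) _)
    have hScard : S.card = q := by
      simp only [S]
      rw [Finset.card_image_of_injective _ (algebraMap (IsLocalRing.ResidueField (v.adicCompletionIntegers ℚ)) (AlgebraicClosure (IsLocalRing.ResidueField (v.adicCompletionIntegers ℚ)))).injective, Finset.card_univ, hq,
        Nat.card_eq_fintype_card]
    have hSroots : S ⊆ f.roots.toFinset := by
      intro a ha
      obtain ⟨a₀, -, rfl⟩ := Finset.mem_image.mp ha
      rw [Multiset.mem_toFinset, Polynomial.mem_roots hf0, Polynomial.IsRoot, eval_sub, eval_pow, eval_X,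
        ← map_pow, hq, ← Fintype.card_eq_nat_card, FiniteField.pow_card, sub_self]
    have hcroot : c ∈ f.roots.toFinset := by
      rw [Multiset.mem_toFinset, Polynomial.mem_roots hf0, Polynomial.IsRoot, eval_sub, eval_pow, eval_X, hc, sub_self]
    have hle : f.roots.toFinset.card ≤ q :=
      (Multiset.toFinset_card_le _).trans ((Polynomial.card_roots' f).trans hdeg.le)
    have hSeq : S = f.roots.toFinset := Finset.eq_of_subset_of_card_le hSroots (by rw [hScard]; exact hle)
    rw [← hSeq] at hcroot
    obtain ⟨c₀, -, hc₀⟩ := Finset.mem_image.mp hcroot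
    exact ⟨c₀, hc₀⟩
  obtain ⟨c₀, hc₀⟩ := hroots _ hxq
  obtain ⟨d₀, hd₀⟩ := hroots _ hyq
  -- the equation over `k̄`, then over `𝔽_v`
  have hMns : (((integralModelInt W).map (algebraMap ℤ ↥w.valuationSubring)).baseChange
      (AlgebraicClosure (v.adicCompletion ℚ))).toAffine.Nonsingular x y := by
    rw [localIntModel_baseChange W w.valuationSubring]; exact h
  have heqO : ((integralModelInt W).map (algebraMap ℤ ↥w.valuationSubring)).toAffine.Equation ⟨x, hx⟩ ⟨y, hy⟩ :=
    (map_equation_iff hvO.hom_inj).mp hMns.1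
  have hZk : (r.comp (algebraMap ℤ ↥w.valuationSubring)) =
      ((algebraMap (IsLocalRing.ResidueField (v.adicCompletionIntegers ℚ)) (AlgebraicClosure (IsLocalRing.ResidueField (v.adicCompletionIntegers ℚ)))).comp (IsLocalRing.residue (v.adicCompletionIntegers ℚ))).comp
        (algebraMap ℤ (v.adicCompletionIntegers ℚ)) :=
    RingHom.ext_int _ _
  have heqkbar : ((((integralModelInt W).map (algebraMap ℤ (v.adicCompletionIntegers ℚ))).map
      (IsLocalRing.residue (v.adicCompletionIntegers ℚ))).map
      (algebraMap (IsLocalRing.ResidueField (v.adicCompletionIntegers ℚ)) (AlgebraicClosure (IsLocalRing.ResidueField (v.adicCompletionIntegers ℚ))))).toAffine.Equation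
      (algebraMap (IsLocalRing.ResidueField (v.adicCompletionIntegers ℚ)) (AlgebraicClosure (IsLocalRing.ResidueField (v.adicCompletionIntegers ℚ))) c₀) (algebraMap (IsLocalRing.ResidueField (v.adicCompletionIntegers ℚ)) (AlgebraicClosure (IsLocalRing.ResidueField (v.adicCompletionIntegers ℚ))) d₀) := by
    rw [hc₀, hd₀, WeierstrassCurve.map_map, WeierstrassCurve.map_map, ← hZk, ← WeierstrassCurve.map_map]
    exact heqO.map r
  have heqk : (((integralModelInt W).map (algebraMap ℤ (v.adicCompletionIntegers ℚ))).map
      (IsLocalRing.residue (v.adicCompletionIntegers ℚ))).toAffine.Equation c₀ d₀ :=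
    (Affine.map_equation _ (algebraMap (IsLocalRing.ResidueField (v.adicCompletionIntegers ℚ)) (AlgebraicClosure (IsLocalRing.ResidueField (v.adicCompletionIntegers ℚ)))).injective c₀ d₀).mp heqkbar
  -- the reduction `W_ℤ ⊗ 𝔽_v` is non-singular (`p ∤ Δ`), so the point is non-singular and lifts (Hensel)
  have hϖ : Irreducible ((p : ℕ) : v.adicCompletionIntegers ℚ) := irreducible_natCast_adicCompletionIntegers_rat hpv
  haveI hchark : CharP (IsLocalRing.ResidueField (v.adicCompletionIntegers ℚ)) p := by
    refine (CharP.charP_iff_prime_eq_zero hp.out).mpr ?_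
    rw [← map_natCast (IsLocalRing.residue (v.adicCompletionIntegers ℚ)), IsLocalRing.residue_eq_zero_iff]
    exact hϖ.not_isUnit
  haveI : ((((integralModelInt W).map (algebraMap ℤ (v.adicCompletionIntegers ℚ))).map
      (IsLocalRing.residue (v.adicCompletionIntegers ℚ)))).IsElliptic := by
    refine ⟨?_⟩
    rw [map_Δ, map_Δ, eq_intCast, map_intCast, isUnit_iff_ne_zero, ne_eq, CharP.intCast_eq_zero_iff _ p]
    exact hΔ
  have hns₀ : (((integralModelInt W).map (algebraMap ℤ (v.adicCompletionIntegers ℚ))).map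
      (IsLocalRing.residue (v.adicCompletionIntegers ℚ))).toAffine.Nonsingular c₀ d₀ :=
    (Affine.equation_iff_nonsingular).mp heqk
  haveI : HenselianLocalRing (v.adicCompletionIntegers ℚ) := inferInstance
  obtain ⟨a, b, hab, hac, hbd⟩ :=
    ((integralModelInt W).map (algebraMap ℤ (v.adicCompletionIntegers ℚ))).exists_equation_residue_eq hns₀
  -- the rational point
  let ι : v.adicCompletionIntegers ℚ →+* AlgebraicClosure (v.adicCompletion ℚ) :=
    (algebraMap (v.adicCompletion ℚ) (AlgebraicClosure (v.adicCompletion ℚ))).comp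
      (algebraMap (v.adicCompletionIntegers ℚ) (v.adicCompletion ℚ))
  have hιZ : ι.comp (algebraMap ℤ (v.adicCompletionIntegers ℚ)) =
      (algebraMap ↥w.valuationSubring (AlgebraicClosure (v.adicCompletion ℚ))).comp
        (algebraMap ℤ ↥w.valuationSubring) := RingHom.ext_int _ _
  have habK : (W.baseChange (AlgebraicClosure (v.adicCompletion ℚ))).toAffine.Equation
      (algebraMap (v.adicCompletion ℚ) (AlgebraicClosure (v.adicCompletion ℚ)) (algebraMap (v.adicCompletionIntegers ℚ) (v.adicCompletion ℚ) a))
      (algebraMap (v.adicCompletion ℚ) (AlgebraicClosure (v.adicCompletion ℚ)) (algebraMap (v.adicCompletionIntegers ℚ) (v.adicCompletion ℚ) b)) := by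
    rw [← localIntModel_baseChange W w.valuationSubring, baseChange, WeierstrassCurve.map_map, ← hιZ,
      ← WeierstrassCurve.map_map]
    exact hab.map ι
  have hnsK : (W.baseChange (AlgebraicClosure (v.adicCompletion ℚ))).toAffine.Nonsingular
      (algebraMap (v.adicCompletion ℚ) (AlgebraicClosure (v.adicCompletion ℚ)) (algebraMap (v.adicCompletionIntegers ℚ) (v.adicCompletion ℚ) a))
      (algebraMap (v.adicCompletion ℚ) (AlgebraicClosure (v.adicCompletion ℚ)) (algebraMap (v.adicCompletionIntegers ℚ) (v.adicCompletion ℚ) b)) :=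
    (Affine.equation_iff_nonsingular).mp habK
  refine ⟨Affine.Point.some _ _ hnsK, fun σ ↦ ?_, ?_⟩
  · -- fixed by `Γ_{ℚ_v}`: the coordinates lie in `ℚ_v`
    rw [localPoints.smul_def, Affine.Point.map_some]
    congr 1
    · exact σ.commutes (algebraMap (v.adicCompletionIntegers ℚ) (v.adicCompletion ℚ) a)
    · exact σ.commutes (algebraMap (v.adicCompletionIntegers ℚ) (v.adicCompletion ℚ) b)
  · -- same reduction: compare the residues in `k̄` through the injective `rt`
    have hint1 : ∀ c : v.adicCompletionIntegers ℚ, w (algebraMap (v.adicCompletion ℚ) (AlgebraicClosure (v.adicCompletion ℚ)) (algebraMap (v.adicCompletionIntegers ℚ) (v.adicCompletion ℚ) c)) ≤ 1 := fun c ↦ by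
      have h1 : (w (algebraMap (v.adicCompletion ℚ) (AlgebraicClosure (v.adicCompletion ℚ)) (algebraMap (v.adicCompletionIntegers ℚ) (v.adicCompletion ℚ) c)) : ℝ) = ‖algebraMap (v.adicCompletionIntegers ℚ) (v.adicCompletion ℚ) c‖ := by
        rw [hw]; exact spectralNorm_extends _
      have h2 : ‖algebraMap (v.adicCompletionIntegers ℚ) (v.adicCompletion ℚ) c‖ ≤ 1 :=
        (Valued.toNormedField.norm_le_one_iff).mpr c.2
      rw [← NNReal.coe_le_coe, h1, NNReal.coe_one]; exact h2
    obtain ⟨hb1, hns1, e1⟩ := reducePoint_congrEquiv_some_of_val_le_one hΔu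
      (localIntModel_baseChange W w.valuationSubring) _ _ hnsK (hint1 a)
    obtain ⟨hy', hns2, e2⟩ := reducePoint_congrEquiv_some_of_val_le_one hΔu
      (localIntModel_baseChange W w.valuationSubring) x y h hx
    rw [hred₀, hred₀, e1, e2, Affine.Point.some.injEq]
    refine ⟨hrt_inj ?_, hrt_inj ?_⟩
    · rw [hrt, hrt]
      exact (hrc a (hint1 a)).trans (by rw [hac]; exact hc₀)
    · rw [hrt, hrt]
      exact (hrc b (hint1 b)).trans (by rw [hbd]; exact hd₀)

/-! ## §D `#Ẽ(k̄_w)[p] ≤ p` at a good ordinary prime -/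

include hΔu hred₀ in
/-- **`Ẽ(k̄_w)[p]` is finite of order `≤ p` at a good ORDINARY `v ∣ p`**: by the ordinary filtration
(`localRed_ordinary_filtration`: `red₀` maps `E[p]` onto `Ẽ[p]` and `ker red₀ ∩ E[p]` is cyclic of order `p`) and
`#E(K̄_v)[p] = p²` (`card_torsionPoints_eq_sq`), the `p`-torsion of the target of `red₀` has at most `p² / p = p`
elements. [cite: GreenbergLNM1716, §1 p. 62] [cite: SilvermanAEC2009, Cor. III.6.4(b)] -/
theorem finite_torsionBy_localRed_target_and_card_le [CharP (IsLocalRing.ResidueField ↥w.valuationSubring) p]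
    (hordA : ∃ P : localPoints W (v.adicCompletion ℚ), (p : ℤ) • P = 0 ∧ red₀ P ≠ 0) :
    Finite {t : (((integralModelInt W).map (algebraMap ℤ ↥w.valuationSubring)).map
        (IsLocalRing.residue ↥w.valuationSubring)).toAffine.Point // p • t = 0} ∧
      Nat.card {t : (((integralModelInt W).map (algebraMap ℤ ↥w.valuationSubring)).map
        (IsLocalRing.residue ↥w.valuationSubring)).toAffine.Point // p • t = 0} ≤ p := by
  obtain ⟨hgenr, hsurj, -⟩ := W.localRed_ordinary_filtration hΔu red₀ hred₀ hordA
  obtain ⟨P₁, hP₁0, hP₁ord, hP₁gen⟩ := hgenr 1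
  rw [pow_one] at hP₁ord
  -- `E[p]` has `p²` elements
  have hp0 : (p : AlgebraicClosure (v.adicCompletion ℚ)) ≠ 0 := by
    rw [← map_natCast (algebraMap ℚ (AlgebraicClosure (v.adicCompletion ℚ)))]
    exact (_root_.map_ne_zero _).mpr (Nat.cast_ne_zero.mpr hp.out.ne_zero)
  have hcardE : Nat.card (AddSubgroup.torsionBy (localPoints W (v.adicCompletion ℚ)) (p : ℤ)) = p ^ 2 :=
    WeierstrassCurve.card_torsionPoints_eq_sq_holds W (AlgebraicClosure (v.adicCompletion ℚ)) (n := p) hp0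
  haveI hfinE : Finite (AddSubgroup.torsionBy (localPoints W (v.adicCompletion ℚ)) (p : ℤ)) :=
    Nat.finite_of_card_ne_zero (by rw [hcardE]; exact pow_ne_zero 2 hp.out.ne_zero)
  -- `red₀` restricted to `E[p]`, onto the `p`-torsion of the target
  let Tp := {t : (((integralModelInt W).map (algebraMap ℤ ↥w.valuationSubring)).map
        (IsLocalRing.residue ↥w.valuationSubring)).toAffine.Point // p • t = 0}
  let ρ : AddSubgroup.torsionBy (localPoints W (v.adicCompletion ℚ)) (p : ℤ) → Tp := fun x ↦
    ⟨red₀ x.1, by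
      have hx := (Submodule.mem_torsionBy_iff _ _).mp x.2
      rw [← map_nsmul, ← natCast_zsmul, hx, map_zero]⟩
  have hρsurj : Function.Surjective ρ := by
    rintro ⟨t, ht⟩
    have ht' : ((p ^ 1 : ℕ) : ℤ) • t = 0 := by rw [pow_one, natCast_zsmul]; exact ht
    obtain ⟨x, hx, hxt⟩ := hsurj 1 t ht'
    rw [pow_one] at hx
    exact ⟨⟨x, (Submodule.mem_torsionBy_iff _ _).mpr hx⟩, Subtype.ext hxt⟩
  haveI : Finite Tp := Finite.of_surjective ρ hρsurj
  refine ⟨inferInstance, ?_⟩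
  -- the fibre over `0` contains the `p` multiples of `P₁`
  have hP₁tor : (p : ℤ) • P₁ = 0 := by
    rw [natCast_zsmul, ← hP₁ord]; exact addOrderOf_nsmul_eq_zero P₁
  let mult : Fin p → AddSubgroup.torsionBy (localPoints W (v.adicCompletion ℚ)) (p : ℤ) := fun i ↦
    ⟨(i : ℕ) • P₁, (Submodule.mem_torsionBy_iff _ _).mpr (by rw [smul_comm, hP₁tor, smul_zero])⟩
  have hmult_inj : Function.Injective mult := by
    intro i j h
    have h' : (i : ℕ) • P₁ = (j : ℕ) • P₁ := congrArg Subtype.val h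
    have := (nsmul_injOn_Iio_addOrderOf (x := P₁)) (by rw [hP₁ord]; exact i.2) (by rw [hP₁ord]; exact j.2) h'
    exact Fin.ext this
  -- count: every fibre of `ρ` has at least `p` elements (translate the fibre over `0`)
  have hfib : ∀ t : Tp, p ≤ Nat.card {x // ρ x = t} := fun t ↦ by
    obtain ⟨x₀, hx₀⟩ := hρsurj t
    let ins : Fin p → {x // ρ x = t} := fun i ↦ ⟨x₀ + mult i, by
      apply Subtype.ext
      change red₀ (x₀.1 + (i : ℕ) • P₁) = t.1
      rw [map_add, map_nsmul, hP₁0, nsmul_zero, add_zero]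
      exact congrArg Subtype.val hx₀⟩
    have hins : Function.Injective ins := fun i j h ↦ hmult_inj (add_left_cancel (congrArg Subtype.val h))
    haveI : Finite {x // ρ x = t} := Subtype.finite
    simpa using Nat.card_le_card_of_injective ins hins
  -- `p · #Tp ≤ Σ_t #fibre = #E[p] = p²`
  haveI : Fintype Tp := Fintype.ofFinite Tp
  have hsum : Nat.card (AddSubgroup.torsionBy (localPoints W (v.adicCompletion ℚ)) (p : ℤ)) =
      ∑ t : Tp, Nat.card {x // ρ x = t} := by
    rw [← Nat.card_sigma]
    exact Nat.card_congr (Equiv.sigmaFiberEquiv ρ).symm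
  have hle : p * Nat.card Tp ≤ p ^ 2 := by
    rw [← hcardE, hsum, Nat.card_eq_fintype_card, mul_comm]
    calc Fintype.card Tp * p = ∑ _t : Tp, p := by rw [Finset.sum_const, Finset.card_univ, smul_eq_mul]
      _ ≤ ∑ t : Tp, Nat.card {x // ρ x = t} := Finset.sum_le_sum fun t _ ↦ hfib t
  rw [pow_two] at hle
  exact Nat.le_of_mul_le_mul_left hle hp.out.pos

end Summit.BirchSwinnertonDyer.BirchSwinnertonDyer.Theorems.GoodOrdTower

end
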